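import Literature.Barriers.ValiantsHypothesis.AlgebraicNaturalProofsKI
import HarnessLib

/-!
# Algebraically natural proofs: KRST's parameters — the permanent-hardness bookkeeping of
# KRST 2022 §3.5 (unconditional), with the succinctness clause isolated

Fourth file of the entry (`AlgebraicNaturalProofs` → `…Generators` → `…KI` → this). It performs
the parameter bookkeeping of Kumar–Ramya–Saptharishi–Tengse 2022, §3.5 ("Putting it all
together") in the tree's constants, so that the hypothesis of the fixed-`n` engine
`isSuccinctHittingSet_of_permanent_hard` — an explicit inequality between the (now unconditional)
Kabanets–Impagliazzo bound and `L(per_m)` — follows from the printed hardness hypothesis on the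
permanent:

* `PermanentExpHardWith F c m₀` — "`Perm_m` requires circuits of size `2^{m^ε}`" in ℕ-arithmetic
  with `ε = 1/c`: `2^j ≤ L(per_{j^c})` for `j ≥ m₀` (identical to the cell planner's
  `PerExpHardWith` at `F = ℂ`; the `∀`-large-`M` form follows by `two_pow_le_complexity_perPoly_of_le`).
* The parameter choice along `n` (KRST: `n = m^{ε/4}`; here, generously, hardness index
  `j = n³`, block permanent `per_M` with `M = krstBlock c n = n^{3c}`, design field `𝔽_p` with
  `p = krstPrime c n` the least prime `≥ M² + n + 1`): `krstPrime_prime`, `lt_krstPrime`,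
  `krstBlock_sq_le_krstPrime`.
* `kiBound_le_two_pow` — the Kabanets–Impagliazzo bound at level `a` with these parameters is
  `≤ 2^{7(E+1)}` for a quadratic `E`; `kiBound_lt_two_pow` — eventually `< 2^{n³}`;
  `kiBound_lt_complexity_perPoly` — hence eventually below `L(per_M)` under
  `PermanentExpHardWith F c m₀`.
* `KRSTSuccinctIn 𝒞 c n` — the succinctness clause for a class (`VNP` slice: KRST §3.4, PROVED
  in `AlgebraicNaturalProofsKRSTVNP.lean`; `VP`: an unproven hypothesis, Summit-side), and the class-generic conclusion
  `isSuccinctHittingSet_of_permanentExpHard` : `PermanentExpHardWith F c m₀` ∧ eventual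
  `𝒞`-succinctness ⟹ eventually `IsSuccinctHittingSet (degLEMonomials n) (𝒞 n) (Distinguishers F n a)`
  for every level `a` — no other hypothesis (Kaltofen's theorem is replaced by the proved root
  closure `RootLifting.lean`).
* The `VP` statement with its one non-kernel input displayed — the succinct-generator
  HYPOTHESIS `KRSTSuccinctInVP` and `succinctHittingSetsForVP_of_permanentExpHard :
  PermanentExpHardWith F c m₀ → KRSTSuccinctInVP F c b → SuccinctHittingSetsForVP F` — lives
  SUMMIT-side (`Summits/ValiantsHypothesis/ValiantsHypothesis/Theorems/BarrierLeverSuccinctHittingSetsForVPKRSTDoor.lean`),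
  because that hypothesis is an unproven, partly refuted statement about the crux and not a result
  in print (ruling of record D-0053: the full algebraic natural-proofs barrier for `VP` is
  CONDITIONAL on a succinct-generator / algebraic-PRF-type hypothesis and is NOT derivable from
  permanent hardness by the known generator technology; kernel no-go theorems:
  `AlgebraicNaturalProofsPlanting.not_jointlySuccinct_of_plantsPermanentAt` for the joint form, and
  the Summit helpers `…KRSTEdge` / `…KRSTEdgeVP` for the per-seed form at `6c ≥ 5b + 24`).

WHAT THIS IS NOT: not a proof of FSV Question 6, not a lower bound; nothing here concerns the `VP`
succinctness hypothesis (Summit-side).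

## References

* [KumarRamyaSaptharishiTengse2022] M. Kumar, C. Ramya, R. Saptharishi, A. Tengse, *If VNP is
  hard, then so are equations for it*, STACS 2022, Thm. MainThm, Lemma 8, §3.3–3.5, §4.
* [Burgisser2024Completeness] P. Bürgisser, *Completeness classes in algebraic complexity theory*,
  arXiv:2406.06217, Thm. 3.2 and §7.3.
-/

noncomputable section

namespace Literature.Barriers.ValiantsHypothesis

open Literature.Computability.AlgebraicComplexity Literature.Computability.MetaComplexity
  MvPolynomial

/-! ### The hardness hypothesis and KRST's parameters -/

section Params

/-- **Exponential hardness of the permanent** (KRST's hypothesis "`Perm_m` requires circuits of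
size `2^{m^ε}`", `ε = 1/c`, in ℕ-arithmetic): `2^j ≤ L(per_{j^c})` over `F` for all `j ≥ m₀`
(an ALMOST-EVERYWHERE subsequence form; print's hypothesis is infinitely-often, §3.5 concluding
note; by `complexity_perPoly_mono` of `PermanentMonotone.lean` the subsequence form gives
`2^j ≤ L(per_M)` for every `M ≥ j^c`). An open hypothesis (it implies `VP ≠ VNP`), never asserted.
[cite: KumarRamyaSaptharishiTengse2022, Thm. MainThm (hypothesis)] -/
def PermanentExpHardWith (F : Type*) [CommSemiring F] (c m₀ : ℕ) : Prop :=
  ∀ j : ℕ, m₀ ≤ j → 2 ^ j ≤ complexity (perPoly (Fin (j ^ c)) F)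

/-- The block permanent size along `n`: `M = n^{3c}` (so that the hardness index is `j = n³`;
KRST take `n = m^{ε/4}`, i.e. `m = n^{4/ε}`). [cite: KumarRamyaSaptharishiTengse2022, §3.5] -/
def krstBlock (c n : ℕ) : ℕ := n ^ (3 * c)

/-- The design field size along `n`: the least prime `p ≥ M² + n + 1` (KRST: "the smallest prime
larger than `m²`"; here also `> n`, so that exponent vectors of degree `≤ n` embed injectively into
`𝔽_p^{n+1}`; still `p ≤ 2(M² + n + 1)` by Bertrand, `leastPrimeGe_le`).
[cite: KumarRamyaSaptharishiTengse2022, §3.5] -/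
def krstPrime (c n : ℕ) : ℕ := leastPrimeGe (krstBlock c n * krstBlock c n + n + 1)

/-- `krstPrime c n` is prime. [cite: KumarRamyaSaptharishiTengse2022, §3.5] -/
theorem krstPrime_prime (c n : ℕ) : (krstPrime c n).Prime := (leastPrimeGe_spec _).2

/-- `n < krstPrime c n`. [cite: KumarRamyaSaptharishiTengse2022, §3.5] -/
theorem lt_krstPrime (c n : ℕ) : n < krstPrime c n :=
  lt_of_lt_of_le (by omega) (leastPrimeGe_spec _).1

/-- `M² ≤ krstPrime c n`: the block of `p` positions holds the `M²` permanent variables.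
[cite: KumarRamyaSaptharishiTengse2022, §3.5] -/
theorem krstBlock_sq_le_krstPrime (c n : ℕ) : krstBlock c n * krstBlock c n ≤ krstPrime c n :=
  le_trans (by omega) (leastPrimeGe_spec _).1

/-- The `Fact` instance making `ZMod (krstPrime c n)` a field. [cite: KumarRamyaSaptharishiTengse2022, §3.5] -/
instance krstPrime.fact (c n : ℕ) : Fact (krstPrime c n).Prime := ⟨krstPrime_prime c n⟩

end Params

/-! ### The bookkeeping: the KI bound is eventually below the hardness -/

section Bookkeeping

/-- The (unconditional) Kabanets–Impagliazzo bound of the fixed-`n` engine at level `a`, block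
permanent `per_M`, `M = n^{3c}`, `p = krstPrime c n` variables (intersection parameter `r = n`,
`deg Perm_[p] ≤ M`; exponent `7` from the root closure).
[cite: KumarRamyaSaptharishiTengse2022, Lemma 8 and §3.5] -/
def kiBound (a c n : ℕ) : ℕ :=
  ((Nat.choose (2 * n) n) ^ a +
    Fintype.card (degLEMonomials n) * ((krstBlock c n + 1) ^ n * (2 * krstBlock c n + 2)) +
    (Nat.choose (2 * n) n) ^ a * max 1 (krstBlock c n) + krstBlock c n + krstPrime c n + 4) ^ 7

/-- `n^k ≤ 2^{k n}`. [folklore] -/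
private theorem pow_le_two_pow_mul (n k : ℕ) : n ^ k ≤ 2 ^ (k * n) := by
  rw [pow_mul', ]
  exact Nat.pow_le_pow_left (Nat.lt_two_pow_self).le k

/-- The exponent bound: `kiBound a c n ≤ 2^{7 (E + 1)}` with
`E = 2an + n² + 3cn² + n + 3cn + 4`. [cite: KumarRamyaSaptharishiTengse2022, §3.5] -/
theorem kiBound_le_two_pow (a c n : ℕ) :
    kiBound a c n ≤ 2 ^ (7 * ((2 * a * n + n ^ 2 + 3 * c * n ^ 2 + n + 3 * c * n + 4) + 1)) := by
  set E := 2 * a * n + n ^ 2 + 3 * c * n ^ 2 + n + 3 * c * n + 4 with hE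
  -- the four summands
  have hN : Nat.choose (2 * n) n ≤ 2 ^ (2 * n) := by
    rw [pow_mul]; exact Nat.centralBinom_le_four_pow n
  have hNa : (Nat.choose (2 * n) n) ^ a ≤ 2 ^ (2 * a * n) := by
    calc (Nat.choose (2 * n) n) ^ a ≤ (2 ^ (2 * n)) ^ a := Nat.pow_le_pow_left hN a
      _ = 2 ^ (2 * a * n) := by rw [← pow_mul]; ring_nf
  have hcard : Fintype.card (degLEMonomials n) ≤ 2 ^ (n ^ 2) := by
    calc Fintype.card (degLEMonomials n) ≤ (n + 1) ^ n := card_degLEMonomials_le n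
      _ ≤ (2 ^ n) ^ n := Nat.pow_le_pow_left Nat.lt_two_pow_self n
      _ = 2 ^ (n ^ 2) := by rw [← pow_mul, sq]
  have ho : 1 ≤ 2 ^ (3 * c * n) := Nat.one_le_two_pow
  have hM : krstBlock c n ≤ 2 ^ (3 * c * n) := pow_le_two_pow_mul n (3 * c)
  have hM1 : krstBlock c n + 1 ≤ 2 ^ (3 * c * n + 1) := by rw [pow_succ]; omega
  have hM2 : 2 * krstBlock c n + 2 ≤ 2 ^ (3 * c * n + 2) := by rw [pow_succ, pow_succ]; omega
  have hmax : max 1 (krstBlock c n) ≤ 2 ^ (3 * c * n) := max_le ho hM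
  have hT2 : Fintype.card (degLEMonomials n) * ((krstBlock c n + 1) ^ n * (2 * krstBlock c n + 2))
      ≤ 2 ^ (n ^ 2 + (3 * c * n + 1) * n + (3 * c * n + 2)) := by
    calc Fintype.card (degLEMonomials n) * ((krstBlock c n + 1) ^ n * (2 * krstBlock c n + 2))
        ≤ 2 ^ (n ^ 2) * ((2 ^ (3 * c * n + 1)) ^ n * 2 ^ (3 * c * n + 2)) :=
          Nat.mul_le_mul hcard (Nat.mul_le_mul (Nat.pow_le_pow_left hM1 n) hM2)
      _ = 2 ^ (n ^ 2 + (3 * c * n + 1) * n + (3 * c * n + 2)) := by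
          rw [← pow_mul, ← pow_add, ← pow_add, add_assoc]
  have hT3 : (Nat.choose (2 * n) n) ^ a * max 1 (krstBlock c n) ≤ 2 ^ (2 * a * n + 3 * c * n) := by
    rw [pow_add]; exact Nat.mul_le_mul hNa hmax
  -- each summand is at most `2^(E-2)`, so the sum is at most `2^E`
  have hsq : (3 * c * n + 1) * n = 3 * c * n ^ 2 + n := by ring
  have h1 : 2 * a * n ≤ E - 2 := by omega
  have h2 : n ^ 2 + (3 * c * n + 1) * n + (3 * c * n + 2) ≤ E - 2 := by omega
  have h3 : 2 * a * n + 3 * c * n ≤ E - 2 := by omega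
  have h4 : (2 : ℕ) ≤ 2 ^ (E - 2) := by
    calc (2 : ℕ) = 2 ^ 1 := by norm_num
      _ ≤ 2 ^ (E - 2) := Nat.pow_le_pow_right (by norm_num) (by omega)
  have e1 : (Nat.choose (2 * n) n) ^ a ≤ 2 ^ (E - 2) :=
    hNa.trans (Nat.pow_le_pow_right (by norm_num) h1)
  have e2 : Fintype.card (degLEMonomials n) *
      ((krstBlock c n + 1) ^ n * (2 * krstBlock c n + 2)) ≤ 2 ^ (E - 2) :=
    hT2.trans (Nat.pow_le_pow_right (by norm_num) h2)
  have e3 : (Nat.choose (2 * n) n) ^ a * max 1 (krstBlock c n) ≤ 2 ^ (E - 2) :=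
    hT3.trans (Nat.pow_le_pow_right (by norm_num) h3)
  -- the two new summands of the unconditional bound: `M` and `p ≤ 2 (M² + n + 1)`
  have e4 : krstBlock c n ≤ 2 ^ (E - 2) :=
    hM.trans (Nat.pow_le_pow_right (by norm_num) (by omega))
  have hn2 : n ≤ n ^ 2 := by
    rcases Nat.eq_zero_or_pos n with h0 | h0
    · simp [h0]
    · rw [sq]; exact Nat.le_mul_of_pos_right n h0
  have hcn : 3 * c * n ≤ 3 * c * n ^ 2 := Nat.mul_le_mul_left _ hn2
  have hnpow : n + 1 ≤ 2 ^ n := Nat.lt_two_pow_self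
  have hMM : krstBlock c n * krstBlock c n ≤ 2 ^ (6 * c * n) := by
    calc krstBlock c n * krstBlock c n ≤ 2 ^ (3 * c * n) * 2 ^ (3 * c * n) := Nat.mul_le_mul hM hM
      _ = 2 ^ (6 * c * n) := by rw [← pow_add]; ring_nf
  have e5 : krstPrime c n ≤ 2 ^ (E - 2) := by
    have hB := leastPrimeGe_le (krstBlock c n * krstBlock c n + n + 1) (by omega)
    unfold krstPrime
    refine hB.trans ?_
    have h6 : 2 ^ (6 * c * n) ≤ 2 ^ (6 * c * n + n) := Nat.pow_le_pow_right (by norm_num) (by omega)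
    have h7 : 2 ^ n ≤ 2 ^ (6 * c * n + n) := Nat.pow_le_pow_right (by norm_num) (by omega)
    calc 2 * (krstBlock c n * krstBlock c n + n + 1) ≤ 2 * (2 ^ (6 * c * n + n) + 2 ^ (6 * c * n + n)) := by
          omega
      _ = 2 ^ (6 * c * n + n + 2) := by rw [pow_add _ (6 * c * n + n) 2]; ring
      _ ≤ 2 ^ (E - 2) := by
          refine Nat.pow_le_pow_right (by norm_num) ?_
          have h66 : 6 * c * n = 3 * c * n + 3 * c * n := by ring
          omega
  have e6 : (4 : ℕ) ≤ 2 ^ (E - 2) := by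
    calc (4 : ℕ) = 2 ^ 2 := by norm_num
      _ ≤ 2 ^ (E - 2) := Nat.pow_le_pow_right (by norm_num) (by omega)
  have hE2 : 8 * 2 ^ (E - 2) = 2 ^ (E + 1) := by
    rw [show (8 : ℕ) = 2 ^ 3 by norm_num, ← pow_add, show 3 + (E - 2) = E + 1 by omega]
  have hsum : (Nat.choose (2 * n) n) ^ a +
      Fintype.card (degLEMonomials n) * ((krstBlock c n + 1) ^ n * (2 * krstBlock c n + 2)) +
      (Nat.choose (2 * n) n) ^ a * max 1 (krstBlock c n) + krstBlock c n + krstPrime c n + 4 ≤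
        2 ^ (E + 1) := by
    calc _ ≤ 2 ^ (E - 2) + 2 ^ (E - 2) + 2 ^ (E - 2) + 2 ^ (E - 2) + 2 ^ (E - 2) + 2 ^ (E - 2) :=
          add_le_add (add_le_add (add_le_add (add_le_add (add_le_add e1 e2) e3) e4) e5) e6
      _ ≤ 8 * 2 ^ (E - 2) := by omega
      _ = 2 ^ (E + 1) := hE2
  unfold kiBound
  calc _ ≤ (2 ^ (E + 1)) ^ 7 := Nat.pow_le_pow_left hsum 7
    _ = 2 ^ (7 * (E + 1)) := by rw [← pow_mul, mul_comm]

/-- **Eventually `kiBound a c n < 2^{n³}`** (a cubic beats the quadratic exponent).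
[cite: KumarRamyaSaptharishiTengse2022, §3.5] -/
theorem kiBound_lt_two_pow (a c : ℕ) :
    ∃ n₀ : ℕ, ∀ n : ℕ, n₀ ≤ n → kiBound a c n < 2 ^ (n ^ 3) := by
  refine ⟨7 * (2 * a + 6 * c + 6) + 9, fun n hn => ?_⟩
  refine lt_of_le_of_lt (kiBound_le_two_pow a c n) (Nat.pow_lt_pow_right (by norm_num) ?_)
  -- `7 (E + 1) < n³` for `n ≥ 7 (2a + 6c + 6) + 9`
  set K := 2 * a + 6 * c + 6 with hK
  have hn1 : 1 ≤ n := by omega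
  have hn2 : n ≤ n ^ 2 := by rw [sq]; exact Nat.le_mul_of_pos_right n hn1
  have hE : 2 * a * n + n ^ 2 + 3 * c * n ^ 2 + n + 3 * c * n + 4 ≤ K * n ^ 2 := by
    have h1 : 2 * a * n ≤ 2 * a * n ^ 2 := Nat.mul_le_mul_left _ hn2
    have h3 : 3 * c * n ≤ 3 * c * n ^ 2 := Nat.mul_le_mul_left _ hn2
    have h4 : 4 ≤ 4 * n ^ 2 := Nat.le_mul_of_pos_right 4 (by positivity)
    calc 2 * a * n + n ^ 2 + 3 * c * n ^ 2 + n + 3 * c * n + 4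
        ≤ 2 * a * n ^ 2 + n ^ 2 + 3 * c * n ^ 2 + n ^ 2 + 3 * c * n ^ 2 + 4 * n ^ 2 := by
          gcongr
      _ = K * n ^ 2 := by rw [hK]; ring
  have hK9 : 7 * K + 9 ≤ n := hn
  have hn9 : 9 ≤ n ^ 2 := le_trans (by omega) hn2
  calc 7 * ((2 * a * n + n ^ 2 + 3 * c * n ^ 2 + n + 3 * c * n + 4) + 1)
      ≤ 7 * (K * n ^ 2 + 1) := by gcongr
    _ = 7 * K * n ^ 2 + 7 := by ring
    _ < 7 * K * n ^ 2 + n ^ 2 := by omega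
    _ = (7 * K + 1) * n ^ 2 := by ring
    _ ≤ n * n ^ 2 := Nat.mul_le_mul_right _ (by omega)
    _ = n ^ 3 := by ring

/-- **Hardness beats the KI bound**: under `PermanentExpHardWith F c m₀`, eventually in `n`,
`kiBound a c n < L(per_{n^{3c}})` (use hardness at `j = n³`, `(n³)^c = n^{3c}`).
[cite: KumarRamyaSaptharishiTengse2022, §3.5] -/
theorem kiBound_lt_complexity_perPoly (F : Type*) [CommSemiring F] {c m₀ : ℕ}
    (hper : PermanentExpHardWith F c m₀) (a : ℕ) :
    ∃ n₀ : ℕ, ∀ n : ℕ, n₀ ≤ n → kiBound a c n < complexity (perPoly (Fin (krstBlock c n)) F) := by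
  obtain ⟨n₁, hn₁⟩ := kiBound_lt_two_pow a c
  refine ⟨max n₁ (max m₀ 1), fun n hn => ?_⟩
  have hn₁' : n₁ ≤ n := (le_max_left _ _).trans hn
  have hm₀n : m₀ ≤ n := (le_max_left _ _).trans ((le_max_right _ _).trans hn)
  have h1 : 1 ≤ n := (le_max_right _ _).trans ((le_max_right _ _).trans hn)
  have hn3 : n ≤ n ^ 3 := by
    calc n = n * 1 * 1 := by ring
      _ ≤ n * n * n := by gcongr
      _ = n ^ 3 := by ring
  have hm₀ : m₀ ≤ n ^ 3 := hm₀n.trans hn3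
  have h := hper (n ^ 3) hm₀
  rw [← pow_mul] at h
  exact (hn₁ n hn₁').trans_le h

end Bookkeeping

/-! ### The succinctness clause and the class-generic conclusion -/

section Main

variable (F : Type*) [Field F]

/-- **The succinctness clause for a class** (KRST §3.4 for their `VNP` slice, PROVED in
`AlgebraicNaturalProofsKRSTVNP.lean`; for `VP` an unproven hypothesis, Summit-side): at size `n` and with KRST's
parameters (`M = n^{3c}`, `p = krstPrime c n`), for every seed `y : 𝔽_p × 𝔽_p → F` the polynomial
`Σ_{|μ| ≤ n} Perm_[p](y|_{S_μ}) x^μ` — `S_μ` the Reed–Solomon block of `μ` — belongs to the class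
`𝒞 n`. [cite: KumarRamyaSaptharishiTengse2022, §3.4–3.5] -/
def KRSTSuccinctIn (𝒞 : ∀ n, Set (MvPolynomial (Fin n) F)) (c n : ℕ) : Prop :=
  ∀ y : ZMod (krstPrime c n) × ZMod (krstPrime c n) → F, ∃ g ∈ 𝒞 n,
    ∀ μ : degLEMonomials n, coeff (μ : Fin n →₀ ℕ) g =
      eval (y ∘ krstDesign (krstPrime c n) n μ) (perPad F (krstBlock_sq_le_krstPrime c n))

variable {F} [CharZero F]

/-- **The class-generic form of KRST's theorem — unconditional apart from the succinctness
clause:** for ANY classes `𝒞 n`, exponential hardness of `per` ∧ eventual `𝒞`-succinctness of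
KRST's generator give, for every level `a`, eventually
`IsSuccinctHittingSet (degLEMonomials n) (𝒞 n) (Distinguishers F n a)`. With `𝒞 n` = KRST's
`VNP` slice the succinctness clause is their §3.4 (proved in the sequel) and the conclusion their
Main Theorem. [cite: KumarRamyaSaptharishiTengse2022, Thm. MainThm] -/
theorem isSuccinctHittingSet_of_permanentExpHard {c m₀ : ℕ}
    {𝒞 : ∀ n, Set (MvPolynomial (Fin n) F)}
    (hper : PermanentExpHardWith F c m₀)
    (hsucc : ∃ n₀ : ℕ, ∀ n : ℕ, n₀ ≤ n → KRSTSuccinctIn F 𝒞 c n) (a : ℕ) :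
    ∃ n₀ : ℕ, ∀ n : ℕ, n₀ ≤ n →
      IsSuccinctHittingSet (degLEMonomials n) (𝒞 n) (Distinguishers F n a) := by
  obtain ⟨n₁, hn₁⟩ := kiBound_lt_complexity_perPoly F hper a
  obtain ⟨n₂, hn₂⟩ := hsucc
  refine ⟨max n₁ n₂, fun n hn => ?_⟩
  exact isSuccinctHittingSet_of_permanent_hard (lt_krstPrime c n) (krstBlock_sq_le_krstPrime c n)
    (hn₁ n ((le_max_left _ _).trans hn)) (hn₂ n ((le_max_right _ _).trans hn))

end Main

end Literature.Barriers.ValiantsHypothesis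

end
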